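import Summits.CriticalPhenomena.SAWScalingLimit.Theorems.SAWLeftRightFKGFKGToTraversalBoundWindowShadow
import HarnessLib

/-!
# Window shadow along a block-monotone index trace: the far-piece cost
(crux `SAWLeftRightFKG.FKGToTraversalBound`, stmt-CriticalPhenomena-1878; line `slit-necklace`,
witness unit U7b, plumbing helper of the registered stub `stub_necklaceWitnessFarU`)

The hugging route `p` of the planar witness carries `q` strictly separated index windows
`[a m, b m]` across the shell `D(y; σ₁, σ₂)` which are PURE: every vertex `p.getVert n` of a window
is shadowed within `ε₀` by the vertex `γ.getVert (cidx n)` of the hugged piece `γ`, with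
`i' < cidx n < j'`.  The index trace `cidx` is monotone (non-decreasing, or non-increasing) on the
window vertices, EXCEPT possibly across one cut `kstar`: pairs `n < kstar ≤ n₂` are unconstrained.
We transfer these windows to `(q - 1) / 4` strictly separated index windows of `γ` inside
`[i' + 1, j' - 1]` across the `ε₀`-thinner shell `D(y; σ₁ + ε₀, σ₂ - ε₀)`
(`hasSepWindows_of_blockMonotone_shadow`):

* at most one window straddles the cut, so `2t` CONSECUTIVE windows (`t = (q - 1) / 4`) lie on one
  side of it — the first `2t` ones if the window number `2t - 1` ends before the cut, the next `2t`
  ones otherwise — and there block-monotonicity is plain monotonicity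
  (`hasSepWindows_of_oneSided_shadow`);
* pushing them forward by `cidx` (read backwards, with swapped ends, in the non-increasing case)
  gives windows of `γ` across the thinner shell (triangle inequality) which are only WEAKLY
  separated, since `cidx` may merge the end of a window with the start of the next one;
* weakly separated windows across a genuine shell halve to strictly separated ones
  (`hasSepWindows_of_le_sep`): keep every other window; the skipped window is non-degenerate
  because its two ends are embedded on opposite sides of the shell.

Generalises `hasSepWindows_of_monotone_shadow` (file `…WindowShadow`).  Pure index bookkeeping
plus the triangle inequality; no literature fact.
-/

noncomputable section

open Set
open Literature.Probability.LatticeModels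

namespace Summit.CriticalPhenomena.SAWScalingLimit.Theorems.FKGToTraversalBound.SlitNecklace

/-- **Weakly separated windows halve to strictly separated ones.**  `2t` index windows
`a m ≤ b m` of `p` inside `[lo, hi]` across a GENUINE shell `D(y; σ₁, σ₂)` (`σ₁ < σ₂`) which are
only weakly separated (`b m ≤ a m'` for `m < m'`) contain `t` strictly separated ones: every other
window.  Indeed each window is non-degenerate (`a m < b m`: its two ends are embedded on opposite
sides of the shell), so the skipped window strictly separates its two neighbours. [folklore] -/
theorem hasSepWindows_of_le_sep {V E : Type*} [PseudoMetricSpace E] {G : SimpleGraph V} {u v : V}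
    (emb : V → E) (p : G.Walk u v) (t lo hi : ℕ) (y : E) (σ₁ σ₂ : ℝ) (hσ : σ₁ < σ₂)
    (a b : Fin (2 * t) → ℕ) (hab : ∀ m, lo ≤ a m ∧ a m ≤ b m ∧ b m ≤ hi)
    (hside : ∀ m, (dist (emb (p.getVert (a m))) y ≤ σ₁ ∧ σ₂ ≤ dist (emb (p.getVert (b m))) y) ∨
      (σ₂ ≤ dist (emb (p.getVert (a m))) y ∧ dist (emb (p.getVert (b m))) y ≤ σ₁))
    (hsep : ∀ ⦃m m' : Fin (2 * t)⦄, m < m' → b m ≤ a m') :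
    HasSepWindows emb p t lo hi y σ₁ σ₂ := by
  -- each window is non-degenerate: its two ends are embedded at different distances from `y`
  have hlt : ∀ m, a m < b m := by
    intro m
    rcases (hab m).2.1.lt_or_eq with h | h
    · exact h
    · exfalso
      have hs := hside m
      rw [h] at hs
      rcases hs with ⟨h1, h2⟩ | ⟨h1, h2⟩ <;> linarith
  -- keep the even-numbered windows (`e`); the odd-numbered ones (`e'`) separate them
  obtain ⟨e, he⟩ : ∃ e : Fin t → Fin (2 * t), ∀ m, (e m : ℕ) = 2 * m :=
    ⟨fun m => ⟨2 * m, by have := m.2; omega⟩, fun m => rfl⟩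
  obtain ⟨e', he'⟩ : ∃ e' : Fin t → Fin (2 * t), ∀ m, (e' m : ℕ) = 2 * m + 1 :=
    ⟨fun m => ⟨2 * m + 1, by have := m.2; omega⟩, fun m => rfl⟩
  refine ⟨fun m => a (e m), fun m => b (e m), fun m => hab (e m), fun m => hside (e m),
    fun m m' hmm' => ?_⟩
  show b (e m) < a (e m')
  have h12 : e m < e' m := Fin.lt_def.2 (by rw [he, he']; omega)
  have h23 : e' m < e m' :=
    Fin.lt_def.2 (by rw [he', he]; have := Fin.lt_def.1 hmm'; omega)
  exact ((hsep h12).trans_lt (hlt (e' m))).trans_le (hsep h23)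

/-- **Window shadow along a one-sided trace.**  `2t` strictly separated pure windows `a m ≤ b m` of
the hugging route `p` across `D(y; σ₁, σ₂)`, every vertex `p.getVert n` of which is shadowed
within `ε₀` by `γ.getVert (cidx n)` with `i' < cidx n < j'`, for an index trace `cidx` monotone
(non-decreasing, or non-increasing) on ALL their vertices, give `t` strictly separated index
windows of `γ` inside `[i' + 1, j' - 1]` across `D(y; σ₁ + ε₀, σ₂ - ε₀)` (provided
`σ₁ + ε₀ < σ₂ - ε₀`): push the windows forward by `cidx` (backwards with swapped ends in the
non-increasing case) and halve (`hasSepWindows_of_le_sep`). [folklore] -/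
theorem hasSepWindows_of_oneSided_shadow {V : Type*} {G : SimpleGraph V} {u v : V}
    {G' : SimpleGraph (Site 2)} {u' v' : Site 2} (δ : ℝ) (emb : V → ℂ) (p : G.Walk u v)
    (γ : G'.Walk u' v') (t : ℕ) (a b : Fin (2 * t) → ℕ) (cidx : ℕ → ℕ) (i' j' : ℕ) (y : ℂ)
    (σ₁ σ₂ ε₀ : ℝ) (hthin : σ₁ + ε₀ < σ₂ - ε₀) (hab : ∀ m, a m ≤ b m)
    (hsep : ∀ ⦃m m' : Fin (2 * t)⦄, m < m' → b m < a m')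
    (hside : ∀ m, (dist (emb (p.getVert (a m))) y ≤ σ₁ ∧ σ₂ ≤ dist (emb (p.getVert (b m))) y) ∨
      (σ₂ ≤ dist (emb (p.getVert (a m))) y ∧ dist (emb (p.getVert (b m))) y ≤ σ₁))
    (hshadow : ∀ (m : Fin (2 * t)) (n : ℕ), a m ≤ n → n ≤ b m → i' < cidx n ∧ cidx n < j' ∧
      dist (emb (p.getVert n)) (meshPoint δ (γ.getVert (cidx n))) ≤ ε₀)
    (hmono : (∀ (m m₂ : Fin (2 * t)) (n n₂ : ℕ), a m ≤ n → n ≤ b m → a m₂ ≤ n₂ → n₂ ≤ b m₂ →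
        n ≤ n₂ → cidx n ≤ cidx n₂) ∨
      (∀ (m m₂ : Fin (2 * t)) (n n₂ : ℕ), a m ≤ n → n ≤ b m → a m₂ ≤ n₂ → n₂ ≤ b m₂ →
        n ≤ n₂ → cidx n₂ ≤ cidx n)) :
    HasSepWindows (meshPoint δ) γ t (i' + 1) (j' - 1) y (σ₁ + ε₀) (σ₂ - ε₀) := by
  -- the shadow of a window vertex is at almost the same distance from `y`
  have hnear : ∀ (m : Fin (2 * t)) (n : ℕ), a m ≤ n → n ≤ b m →
      dist (meshPoint δ (γ.getVert (cidx n))) y ≤ dist (emb (p.getVert n)) y + ε₀ ∧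
        dist (emb (p.getVert n)) y ≤ dist (meshPoint δ (γ.getVert (cidx n))) y + ε₀ := by
    intro m n h1 h2
    have h := (hshadow m n h1 h2).2.2
    have t1 := dist_triangle_left (meshPoint δ (γ.getVert (cidx n))) y (emb (p.getVert n))
    have t2 := dist_triangle (emb (p.getVert n)) (meshPoint δ (γ.getVert (cidx n))) y
    constructor <;> linarith
  -- so the shadows of the two ends of a window lie on opposite sides of the thinner shell
  have hsideγ : ∀ m, (dist (meshPoint δ (γ.getVert (cidx (a m)))) y ≤ σ₁ + ε₀ ∧
        σ₂ - ε₀ ≤ dist (meshPoint δ (γ.getVert (cidx (b m)))) y) ∨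
      (σ₂ - ε₀ ≤ dist (meshPoint δ (γ.getVert (cidx (a m)))) y ∧
        dist (meshPoint δ (γ.getVert (cidx (b m)))) y ≤ σ₁ + ε₀) := by
    intro m
    have hA := hnear m (a m) le_rfl (hab m)
    have hB := hnear m (b m) (hab m) le_rfl
    rcases hside m with ⟨h1, h2⟩ | ⟨h1, h2⟩
    · exact Or.inl ⟨by linarith [hA.1], by linarith [hB.2]⟩
    · exact Or.inr ⟨by linarith [hA.2], by linarith [hB.1]⟩
  -- and inside the index range `[i' + 1, j' - 1]`
  have hrange : ∀ (m : Fin (2 * t)) (n : ℕ), a m ≤ n → n ≤ b m →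
      i' + 1 ≤ cidx n ∧ cidx n ≤ j' - 1 := by
    intro m n h1 h2
    have h := hshadow m n h1 h2
    have h' := h.2.1
    exact ⟨h.1, by omega⟩
  rcases hmono with hmono | hanti
  · -- non-decreasing trace: push the windows forward
    refine hasSepWindows_of_le_sep (meshPoint δ) γ t (i' + 1) (j' - 1) y (σ₁ + ε₀) (σ₂ - ε₀)
      hthin (fun m => cidx (a m)) (fun m => cidx (b m)) (fun m => ?_) hsideγ
      (fun m m' hmm' => ?_)
    · exact ⟨(hrange m (a m) le_rfl (hab m)).1,
        hmono m m (a m) (b m) le_rfl (hab m) (hab m) le_rfl (hab m),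
        (hrange m (b m) (hab m) le_rfl).2⟩
    · exact hmono m m' (b m) (a m') (hab m) le_rfl le_rfl (hab m') (hsep hmm').le
  · -- non-increasing trace: push the windows forward, read backwards with swapped ends
    refine hasSepWindows_of_le_sep (meshPoint δ) γ t (i' + 1) (j' - 1) y (σ₁ + ε₀) (σ₂ - ε₀)
      hthin (fun m => cidx (b (Fin.rev m))) (fun m => cidx (a (Fin.rev m))) (fun m => ?_)
      (fun m => ?_) (fun m m' hmm' => ?_)
    · exact ⟨(hrange _ (b (Fin.rev m)) (hab _) le_rfl).1,
        hanti _ _ (a (Fin.rev m)) (b (Fin.rev m)) le_rfl (hab _) (hab _) le_rfl (hab _),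
        (hrange _ (a (Fin.rev m)) le_rfl (hab _)).2⟩
    · show (dist (meshPoint δ (γ.getVert (cidx (b (Fin.rev m))))) y ≤ σ₁ + ε₀ ∧
          σ₂ - ε₀ ≤ dist (meshPoint δ (γ.getVert (cidx (a (Fin.rev m))))) y) ∨
        (σ₂ - ε₀ ≤ dist (meshPoint δ (γ.getVert (cidx (b (Fin.rev m))))) y ∧
          dist (meshPoint δ (γ.getVert (cidx (a (Fin.rev m))))) y ≤ σ₁ + ε₀)
      rcases hsideγ (Fin.rev m) with ⟨h1, h2⟩ | ⟨h1, h2⟩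
      · exact Or.inr ⟨h2, h1⟩
      · exact Or.inl ⟨h2, h1⟩
    · have hr : Fin.rev m' < Fin.rev m := Fin.rev_lt_rev.2 hmm'
      exact hanti _ _ (b (Fin.rev m')) (a (Fin.rev m)) (hab _) le_rfl le_rfl (hab _) (hsep hr).le

/-- **Far-piece cost: window shadow along a block-monotone trace.**  Let the hugging route `p`
carry `q` strictly separated windows `a m ≤ b m ≤ p.length` across `D(y; σ₁, σ₂)` which are pure:
every vertex `p.getVert n`, `a m ≤ n ≤ b m`, is within `ε₀` of `meshPoint δ (γ.getVert (cidx n))`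
with `i' < cidx n < j'`, for an index trace `cidx` which is non-decreasing (or non-increasing) on
pairs of window vertices `n < n₂` not separated by the cut `kstar` (`n₂ < kstar` or `kstar ≤ n`).
If `σ₁ + ε₀ < σ₂ - ε₀`, then `γ` has `(q - 1) / 4` strictly separated index windows inside
`[i' + 1, j' - 1]` across `D(y; σ₁ + ε₀, σ₂ - ε₀)`: at most one window of `p` straddles the cut, so
`2 ((q - 1) / 4)` consecutive windows lie on one side of it, where `hasSepWindows_of_oneSided_shadow`
applies. [folklore] -/
theorem hasSepWindows_of_blockMonotone_shadow : ∀ {V : Type*} {G : SimpleGraph V} {u v : V}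
    {G' : SimpleGraph (Site 2)} {u' v' : Site 2} (δ : ℝ) (emb : V → ℂ) (p : G.Walk u v)
    (γ : G'.Walk u' v') (q : ℕ) (a b : Fin q → ℕ) (cidx : ℕ → ℕ) (kstar i' j' : ℕ) (y : ℂ)
    (σ₁ σ₂ ε₀ : ℝ), 0 ≤ ε₀ → σ₁ + ε₀ < σ₂ - ε₀ → j' ≤ γ.length →
    (∀ m, a m ≤ b m ∧ b m ≤ p.length) → (∀ ⦃m m' : Fin q⦄, m < m' → b m < a m') →
    (∀ m, (dist (emb (p.getVert (a m))) y ≤ σ₁ ∧ σ₂ ≤ dist (emb (p.getVert (b m))) y) ∨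
      (σ₂ ≤ dist (emb (p.getVert (a m))) y ∧ dist (emb (p.getVert (b m))) y ≤ σ₁)) →
    (∀ (m : Fin q) (n : ℕ), a m ≤ n → n ≤ b m → i' < cidx n ∧ cidx n < j' ∧
      dist (emb (p.getVert n)) (meshPoint δ (γ.getVert (cidx n))) ≤ ε₀) →
    ((∀ (m m₂ : Fin q) (n n₂ : ℕ), a m ≤ n → n ≤ b m → a m₂ ≤ n₂ → n₂ ≤ b m₂ → n < n₂ →
        (n₂ < kstar ∨ kstar ≤ n) → cidx n ≤ cidx n₂) ∨
      (∀ (m m₂ : Fin q) (n n₂ : ℕ), a m ≤ n → n ≤ b m → a m₂ ≤ n₂ → n₂ ≤ b m₂ → n < n₂ →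
        (n₂ < kstar ∨ kstar ≤ n) → cidx n₂ ≤ cidx n)) →
    HasSepWindows (meshPoint δ) γ ((q - 1) / 4) (i' + 1) (j' - 1) y (σ₁ + ε₀) (σ₂ - ε₀) := by
  intro V G u v G' u' v' δ emb p γ q a b cidx kstar i' j' y σ₁ σ₂ ε₀ _ hthin _ hab hsep hside
    hshadow hmono
  -- fewer than five windows: nothing to produce
  rcases Nat.eq_zero_or_pos ((q - 1) / 4) with ht | ht
  · rw [ht]; exact hasSepWindows_zero _ _ _ _ _ _ _
  have hq : 4 * ((q - 1) / 4) + 1 ≤ q := by omega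
  generalize (q - 1) / 4 = t at ht hq ⊢
  -- at most one window straddles the cut `kstar`, so `2t` consecutive windows lie on one side of
  -- it: the first `2t` ones if the window number `2t - 1` ends before the cut, the next `2t` otherwise
  obtain ⟨c, hc⟩ : ∃ c : Fin q, (c : ℕ) = 2 * t - 1 := ⟨⟨2 * t - 1, by omega⟩, rfl⟩
  obtain ⟨s, hsq, hcut⟩ : ∃ s, s + 2 * t ≤ q ∧
      ((∀ m : Fin q, s ≤ (m : ℕ) → (m : ℕ) < s + 2 * t → b m < kstar) ∨
        (∀ m : Fin q, s ≤ (m : ℕ) → (m : ℕ) < s + 2 * t → kstar ≤ a m)) := by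
    by_cases hck : b c < kstar
    · refine ⟨0, by omega, Or.inl fun m _ hm => ?_⟩
      rcases (Fin.le_def.2 (by omega) : m ≤ c).lt_or_eq with h | h
      · exact ((hsep h).trans_le (hab c).1).trans hck
      · rw [h]; exact hck
    · refine ⟨2 * t, by omega, Or.inr fun m hm _ => ?_⟩
      have h : c < m := Fin.lt_def.2 (by omega)
      exact (not_lt.1 hck).trans (hsep h).le
  -- on that side the cut separates no pair of window vertices
  have hpair : ∀ (m m₂ : Fin q) (n n₂ : ℕ), s ≤ (m : ℕ) → (m : ℕ) < s + 2 * t → s ≤ (m₂ : ℕ) →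
      (m₂ : ℕ) < s + 2 * t → a m ≤ n → n₂ ≤ b m₂ → n₂ < kstar ∨ kstar ≤ n := by
    intro m m₂ n n₂ h1 h2 h3 h4 h5 h6
    rcases hcut with h | h
    · exact Or.inl (h6.trans_lt (h m₂ h3 h4))
    · exact Or.inr ((h m h1 h2).trans h5)
  -- re-index the `2t` one-sided windows by `Fin (2 * t)`
  obtain ⟨ι, hι⟩ : ∃ ι : Fin (2 * t) → Fin q, ∀ m, (ι m : ℕ) = s + m :=
    ⟨fun m => ⟨s + m, by have := m.2; omega⟩, fun m => rfl⟩
  have hιs : ∀ m, s ≤ (ι m : ℕ) ∧ (ι m : ℕ) < s + 2 * t := fun m => by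
    rw [hι]; have := m.2; omega
  have hιlt : ∀ ⦃m m' : Fin (2 * t)⦄, m < m' → ι m < ι m' := fun m m' h =>
    Fin.lt_def.2 (by rw [hι, hι]; have := Fin.lt_def.1 h; omega)
  refine hasSepWindows_of_oneSided_shadow δ emb p γ t (fun m => a (ι m)) (fun m => b (ι m)) cidx
    i' j' y σ₁ σ₂ ε₀ hthin (fun m => (hab (ι m)).1) (fun m m' h => hsep (hιlt h))
    (fun m => hside (ι m)) (fun m n h1 h2 => hshadow (ι m) n h1 h2) ?_
  -- where block-monotonicity is plain monotonicity
  refine hmono.imp (fun h m m₂ n n₂ h1 h2 h3 h4 h5 => ?_) (fun h m m₂ n n₂ h1 h2 h3 h4 h5 => ?_)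
  · rcases h5.lt_or_eq with h5 | rfl
    · exact h (ι m) (ι m₂) n n₂ h1 h2 h3 h4 h5
        (hpair (ι m) (ι m₂) n n₂ (hιs m).1 (hιs m).2 (hιs m₂).1 (hιs m₂).2 h1 h4)
    · exact le_rfl
  · rcases h5.lt_or_eq with h5 | rfl
    · exact h (ι m) (ι m₂) n n₂ h1 h2 h3 h4 h5
        (hpair (ι m) (ι m₂) n n₂ (hιs m).1 (hιs m).2 (hιs m₂).1 (hιs m₂).2 h1 h4)
    · exact le_rfl

end Summit.CriticalPhenomena.SAWScalingLimit.Theorems.FKGToTraversalBound.SlitNecklace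

end
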